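import Summits.BirchSwinnertonDyer.BirchSwinnertonDyer.Theorems.GenusKolyvaginAtTwoPowDvdShaCardAtTwoRTBottomRungSocket
import HarnessLib

/-!
# Route `GenusKolyvaginAtTwo`, crux L_T `PowDvdShaCardAtTwoRT` (stmt-BirchSwinnertonDyer-23242), LINE 18 `plus_descent` v5.3, stub W-UP
# (`stub_grossWitnessAtTwo`, «crux witness (index ≥ 1) ⟹ level-2 GROSS witness of index ≥ 2»): THE TRIVIAL BRANCH `M₀ = 0`

Width seat `bsd-line-gk2-p5` g25 (cell `bsd-f1-sign2`, SUPPLY lineage). THEOREMS ONLY (no definition, no named fact, no `sorry`);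
helper `--supports stmt-BirchSwinnertonDyer-23242`; no item is closed; BSD is not proved by any of this.

WHAT. The input of the bottom rung on the cut habitat (`RelaxedCount.hbot_socket_margin_onHabitat`, gk2-p5 g24 p728398, and the LEAD's
`exists_deep_notTwoDvd_of_witness_onHabitat`) is a GROSS witness: a square-free `n₀` all of whose primes are Zhang–Kolyvagin at `2` of
index `≥ 2` with `Frob_ℓ = Frob_∞` on `K(E[2])` (`FrobEqFrobInfty W K 2 ℓ`), and a datum `e₀` with `P(n₀) ∉ 2E(K[n₀])`.  The crux frame
(U_T / L_T rev 33, and 22136's conclusion) only carries a ZHANG witness (index `≥ 1`, no Frobenius condition) — the LEAD's v5.3 stub W-UP is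
the bridge.  This file records the branch of W-UP that needs no arithmetic: when the Heegner point itself is `2`-indivisible in `E(K[1])`
(`M₀ = 0` in the frame's exact-divisibility binders `hdiv`/`hndiv`), the conductor-`1` datum IS a Gross witness (`n₀ = 1`: no primes, every
prime condition vacuous):

* `exists_grossWitness_of_not_two_dvd_derivedPoint_one` — `P(1) ∉ 2E(K[1]) ⟹` a Gross witness of index `≥ 2` (indeed of any index / any
  extra prime condition `G`), namely `(1, d₁)`;
* `exists_grossWitness_of_M₀_eq_zero` — the same from the frame's binder `¬ ∃ Q, 2^(M₀+1) • Q = P(1)` with `M₀ = 0`.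

So W-UP is open only for `M₀ ≥ 1`, where (seat memo `Lines/plus-descent-wup-gk2p5.md`) it is the LEVEL-2 (`M = 1`) run of the bottom-rung
engine (LEAD g16 memo §3), not a bookkeeping step; the supply lineage's recommendation is the pen's (β″) restate of the witness clause.

References: [GrossLMS1991] §3 (3.1)–(3.3), §4 (`P_1 = y_K`); [McCallumLMS1991] §5 (the sequence `M₀ ≥ M₁ ≥ …`).
-/

set_option linter.dupNamespace false -- tree convention: `Summit.BirchSwinnertonDyer.BirchSwinnertonDyer.Theorems` (summit = sub-problem)
set_option autoImplicit false

noncomputable section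

open scoped Classical

namespace Summit.BirchSwinnertonDyer.BirchSwinnertonDyer.Theorems.GenusExact.RelaxedCount

open WeierstrassCurve NumberField Literature.NumberTheory.EllipticCurves

variable (W : WeierstrassCurve ℚ) {K : Type} [Field K] [NumberField K]
  {N : ℕ} [NeZero N] (Dt : ModularForms.ModularParametrizationData W N) (β : ℤ) (ι : K →+* ℂ)

/-- **W-UP, trivial branch: `P(1) ∉ 2E(K[1])` makes `(1, d₁)` a Gross witness** — square-free, with EVERY per-prime condition `G`
(Zhang–Kolyvagin, index `≥ 2`, `Frob_ℓ = Frob_∞`, depth, …) holding vacuously on `(1).primeFactors = ∅`, and the same non-divisibility.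
[cite: GrossLMS1991, §4 (P_1 = y_K, p. 242)] -/
theorem exists_grossWitness_of_not_two_dvd_derivedPoint_one (G : ℕ → Prop) (d₁ : KolyvaginHeegnerData Dt β ι 1)
    (h : ¬ ∃ Q : (W.baseChange (ringClassField K ι 1)).toAffine.Point, (2 : ℤ) • Q = d₁.derivedPoint) :
    ∃ (n₀ : ℕ) (e₀ : KolyvaginHeegnerData Dt β ι n₀), Squarefree n₀ ∧ (∀ q ∈ n₀.primeFactors, G q) ∧
      ¬ ∃ Q : (W.baseChange (ringClassField K ι n₀)).toAffine.Point, (2 : ℤ) • Q = e₀.derivedPoint :=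
  ⟨1, d₁, squarefree_one, fun q hq ↦ absurd hq (by simp [Nat.primeFactors_one]), h⟩

/-- **W-UP, trivial branch, in the letter of the bottom rung's input** (`hn₀K` of `hbot_socket_margin_onHabitat` /
`exists_deep_notTwoDvd_of_witness_onHabitat`: Zhang–Kolyvagin at `2`, index `≥ 2`, `FrobEqFrobInfty W K 2`), from the frame's
exact-divisibility binder at `M₀ = 0`: `¬ ∃ Q, 2^(M₀+1) • Q = P(1)` with `M₀ = 0` is `P(1) ∉ 2E(K[1])`.
[cite: GrossLMS1991, §3 (3.1)–(3.3) and §4] [cite: McCallumLMS1991, §5 proof of Lemma 5.1 (M₀)] -/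
theorem exists_grossWitness_of_M₀_eq_zero [W.IsGloballyMinimal] (d₁ : KolyvaginHeegnerData Dt β ι 1) {M₀ : ℕ} (hM₀ : M₀ = 0)
    (hndiv : ¬ ∃ Q : (W.baseChange (ringClassField K ι 1)).toAffine.Point, ((2 ^ (M₀ + 1) : ℕ) : ℤ) • Q = d₁.derivedPoint) :
    ∃ (n₀ : ℕ) (e₀ : KolyvaginHeegnerData Dt β ι n₀), Squarefree n₀ ∧
      (∀ q ∈ n₀.primeFactors, Zhang2014.IsKolyvaginPrime (W.conductorNorm ℤ) W K 2 q ∧ 2 ≤ Zhang2014.kolyvaginIndex W 2 q ∧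
        FrobEqFrobInfty W K 2 q) ∧
      ¬ ∃ Q : (W.baseChange (ringClassField K ι n₀)).toAffine.Point, (2 : ℤ) • Q = e₀.derivedPoint := by
  subst hM₀
  refine exists_grossWitness_of_not_two_dvd_derivedPoint_one W Dt β ι _ d₁ fun ⟨Q, hQ⟩ ↦ hndiv ⟨Q, ?_⟩
  rw [← hQ]
  norm_num

end Summit.BirchSwinnertonDyer.BirchSwinnertonDyer.Theorems.GenusExact.RelaxedCount

end
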